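import Mathlib
import HarnessLib
import Summits.HubbardSuperconductivity.HubbardSuperconductivity.Theorems.KLProgrammeKLRegimeWickAbsChannelsGeneral

/-!
# Route `KLProgramme` — ENGINE child (gen-6 `KLRegimeEngineV16`, stmt-HubbardSuperconductivity-20236), stub `stub_engine_step_values`, (E2): the three-channel
# reading at GENERAL EXTERNAL FREQUENCIES `x = (k, ω)`, `y = (k′, ω′)` for an arbitrary scaling-invariant even vertex `W` — part 2: ph-crossed, assembled identity
# (E2-WICK-ROADMAP §5 (iii-g); cell gate-hubbard-kl, seat p1 g9; for the continuous route's full source matrix on `S × F`)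

§1 `bubbleSumW_phCrossed_general` — the crossed particle–hole channel with transfer frequency `ω + ω′` (`n(p′) + n(ω) + n(ω′) + 1 = n(p)`,
`p⃗′ = p⃗ + Q − k − k′`), as a conditional loop sum; §2 **`vertexFnW_dblFold_bubble_general`** —
`𝒱₄(dblFold(Δ_×(C₁)Δ_×(C₂)(W⁰W¹)))((ω′,k′)↑+, (−ω′,Q−k′)↓+, (−ω,Q−k)↓−, (ω,k)↑−) = 2(βL²)⁻³(PP + PHd − PHx − 2·S62)` for every scaling-invariant even `W`,
diagonal lines `C₁, C₂` and ALL external labels `(k,ω), (k′,ω′)` — i.e. entrywise on the whole carrier `(TorusSite 2 L × MatsubaraIdx M)²`, the form in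
which the continuous organisation's source `X(t)` is read (at `ω = ω′ = ω₀` it is `vertexFnW_dblFold_bubble_pairLabels`, up to the diagonalisation of
the direct channel's conditional sum).  Proved; no definitions.
-/

noncomputable section

namespace Summit.HubbardSuperconductivity.HubbardSuperconductivity.Theorems.KLRegimeWickAbs

set_option linter.dupNamespace false -- summit = problem name (single-conjunct summit), D-0017

open Literature.MathematicalPhysics.QuantumLattice GrassmannAlgebra Finset Matrix
open Literature.Probability.LatticeModels
open Summit.HubbardSuperconductivity.HubbardSuperconductivity.Theorems.TwoPointAssembly
open Summit.HubbardSuperconductivity.HubbardSuperconductivity.Theorems.KLProgrammeLegKernels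
open Summit.HubbardSuperconductivity.HubbardSuperconductivity.Theorems.KLRegimeSplit
open Summit.HubbardSuperconductivity.HubbardSuperconductivity.Theorems.KLRegimeWick

section Model

variable {L M : ℕ} [NeZero L] [NeZero M] (β : ℝ) {W : HubbardGrassmann L M}
  (hWinv : ∀ φ : FreqMomentum L M × Fin 2 → ℂ, (∀ p, φ p ≠ 0) →
    (∀ k₁ k₂ k₃ k₄ : FreqMomentum L M,
      matsubaraInt M k₁.1 + matsubaraInt M k₃.1 = matsubaraInt M k₂.1 + matsubaraInt M k₄.1 ∧ k₁.2 + k₃.2 = k₂.2 + k₄.2 →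
        φ (k₁, 0) * φ (k₃, 1) = φ (k₂, 0) * φ (k₄, 1)) →
    ExteriorAlgebra.map (LinearMap.mulLeft ℂ (scalingWeight φ)) W = W)
include hWinv

/-! ## §1 The crossed particle–hole channel at general external frequencies -/

omit [NeZero M] in
/-- **`bubbleSumW_phCrossed_general`** — the crossed particle–hole channel of `kernel_dblFold_bubble_self` at the pair labels with GENERAL external
frequencies (`a`-legs `Z₀ = (ω′,k′)↑+`, `Z₂ = (−ω,Q−k)↓−`; `b`-legs `Z₁ = (−ω′,Q−k′)↓+`, `Z₃ = (ω,k)↑−`; cf. `bubbleSumW_phCrossed_pairLabels` at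
`ω = ω′ = ω₀`), for diagonal lines: a loop sum over `p` (spin `↑` on the `ψ̂⁻_{p}` end forced, `↓` on the other), the second line end `p′`
restricted by the conservation condition at the `a`-vertex — frequency transfer `ω + ω′` (`n(p′) + n(ω) + n(ω′) + 1 = n(p)`), momentum
transfer `p⃗′ = p⃗ + Q − k − k′`:
`= −c₄⁻²·Σ_p Σ_{p′} [cond]·(ℓ₂(p)ℓ₁(p′) + ℓ₁(p)ℓ₂(p′))·𝒱₄(W)(ψ̂⁻_{p↑}, ψ̂⁺_{p′↓}, Z₀, Z₂)·𝒱₄(W)(ψ̂⁺_{p↑}, ψ̂⁻_{p′↓}, Z₁, Z₃)`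
— the exchange bubble at transfer `k + k′ − Q` (E2-DRIVE's Kohn–Luttinger source). -/
theorem bubbleSumW_phCrossed_general (hβ : β ≠ 0) (ω ω' : MatsubaraIdx M) {C₁ C₂ : Matrix (HubbardFieldIdx L M) (HubbardFieldIdx L M) ℂ}
    {ℓ₁ ℓ₂ : FreqMomentum L M → ℂ} (h₁ : contr ℂ C₁ = diagContr L M ℓ₁) (h₂ : contr ℂ C₂ = diagContr L M ℓ₂) (Q k k' : TorusSite 2 L) :
    ∑ X, ∑ Y, ∑ X', ∑ Y', contr ℂ C₂ X Y * contr ℂ C₁ X' Y' *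
        (kernel ℂ W 4 ![X, X', (((ω', k'), 0), 0), (((ω.rev, Q - k), 1), 1)] *
          kernel ℂ W 4 ![Y, Y', (((ω'.rev, Q - k'), 1), 0), (((ω, k), 0), 1)]) =
      -((((Nat.factorial 4 : ℝ) * (β * (L : ℝ) ^ 2) ^ 3 : ℝ) : ℂ)⁻¹ ^ 2 *
        ∑ p : FreqMomentum L M, ∑ p' : FreqMomentum L M,
          if matsubaraInt M p'.1 + matsubaraInt M ω + matsubaraInt M ω' + 1 = matsubaraInt M p.1 ∧ p'.2 = p.2 + Q - k - k' then
            (ℓ₂ p * ℓ₁ p' + ℓ₁ p * ℓ₂ p') *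
              (vertexFn L M β W 4
                  ![((p, 0), 1), ((p', 1), 0), (((ω', k'), 0), 0), (((ω.rev, Q - k), 1), 1)] *
                vertexFn L M β W 4
                  ![((p, 0), 0), ((p', 1), 1), (((ω'.rev, Q - k'), 1), 0), (((ω, k), 0), 1)])
          else 0) := by
  set Z₀ : HubbardFieldIdx L M := (((ω', k'), 0), 0) with hZ₀
  set Z₂ : HubbardFieldIdx L M := (((ω.rev, Q - k), 1), 1) with hZ₂
  set Z₁ : HubbardFieldIdx L M := (((ω'.rev, Q - k'), 1), 0) with hZ₁
  set Z₃ : HubbardFieldIdx L M := (((ω, k), 0), 1) with hZ₃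
  -- Step 1: line reductions
  rw [h₁, h₂]
  simp_rw [mul_assoc, ← Finset.mul_sum]
  rw [sum_diagContr_mul]
  simp_rw [sum_diagContr_mul]
  -- Step 2: charge conservation at the `a`-vertex (legs `ψ̂⁺ψ̂⁻`)
  have hv : ∀ (p p' : FreqMomentum L M) (σ σ' c : Fin 2), kernel ℂ W 4 ![((p, σ), c), ((p', σ'), c), Z₀, Z₂] = 0 :=
    fun p p' σ σ' c => kernel_ph_same_charge hWinv p p' σ σ' c _ _
  simp only [hv, zero_mul, sub_zero, zero_sub, mul_neg, Finset.sum_neg_distrib, Finset.mul_sum]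
  -- Step 3: merge the two orientation terms
  have hB : ∑ p : FreqMomentum L M, ∑ σ : Fin 2, ∑ p' : FreqMomentum L M, ∑ σ' : Fin 2, ℓ₂ p * (ℓ₁ p' *
        (kernel ℂ W 4 ![((p, σ), 0), ((p', σ'), 1), Z₀, Z₂] * kernel ℂ W 4 ![((p, σ), 1), ((p', σ'), 0), Z₁, Z₃])) =
      ∑ p : FreqMomentum L M, ∑ σ : Fin 2, ∑ p' : FreqMomentum L M, ∑ σ' : Fin 2, ℓ₂ p' * (ℓ₁ p *
        (kernel ℂ W 4 ![((p, σ), 1), ((p', σ'), 0), Z₀, Z₂] * kernel ℂ W 4 ![((p, σ), 0), ((p', σ'), 1), Z₁, Z₃])) := by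
    rw [sum_swap_pairs]
    refine Finset.sum_congr rfl fun p _ => Finset.sum_congr rfl fun σ _ => Finset.sum_congr rfl fun p' _ =>
      Finset.sum_congr rfl fun σ' _ => ?_
    rw [kernel_four_swap01 W ((p, σ), 1) ((p', σ'), 0), kernel_four_swap01 W ((p, σ), 0) ((p', σ'), 1)]
    ring
  -- Step 4: conservation at the `a`-vertex: spins `(↑, ↓)`, frequency lowered by one, momentum shifted by `Q − k − k′`
  have hcons : ∀ (p : FreqMomentum L M) (g : FreqMomentum L M → FreqMomentum L M → ℂ),
      ∑ σ : Fin 2, ∑ p' : FreqMomentum L M, ∑ σ' : Fin 2, g p p' *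
        (kernel ℂ W 4 ![((p, σ), 1), ((p', σ'), 0), Z₀, Z₂] * kernel ℂ W 4 ![((p, σ), 0), ((p', σ'), 1), Z₁, Z₃]) =
      ∑ p' : FreqMomentum L M, if matsubaraInt M p'.1 + matsubaraInt M ω + matsubaraInt M ω' + 1 = matsubaraInt M p.1 ∧ p'.2 = p.2 + Q - k - k' then
        g p p' * (kernel ℂ W 4 ![((p, 0), 1), ((p', 1), 0), Z₀, Z₂] * kernel ℂ W 4 ![((p, 0), 0), ((p', 1), 1), Z₁, Z₃]) else 0 := by
    intro p g
    have hz : ∀ (p' : FreqMomentum L M) (σ σ' : Fin 2),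
        ¬(matsubaraInt M p'.1 + matsubaraInt M ω + matsubaraInt M ω' + 1 = matsubaraInt M p.1 ∧ p'.2 = p.2 + Q - k - k' ∧ σ = 0 ∧ σ' = 1) →
          kernel ℂ W 4 ![((p, σ), 1), ((p', σ'), 0), Z₀, Z₂] = 0 :=
      fun p' σ σ' h => kernel_phx_eq_zero_of_not_gen hWinv Q k k' ω ω' p p' σ σ' h
    rw [Finset.sum_comm]
    refine Finset.sum_congr rfl fun p' _ => ?_
    simp only [Fin.sum_univ_two, Fin.isValue]
    rw [hz p' 0 0 (by simp), hz p' 1 0 (by simp), hz p' 1 1 (by simp)]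
    by_cases hc : matsubaraInt M p'.1 + matsubaraInt M ω + matsubaraInt M ω' + 1 = matsubaraInt M p.1 ∧ p'.2 = p.2 + Q - k - k'
    · rw [if_pos hc]; ring
    · rw [if_neg hc, hz p' 0 1 (fun h => hc ⟨h.1, h.2.1⟩)]; ring
  have hmerge : ∀ p : FreqMomentum L M,
      ∑ σ : Fin 2, (-(∑ p' : FreqMomentum L M, ∑ σ' : Fin 2, ℓ₂ p * (ℓ₁ p' *
          (kernel ℂ W 4 ![((p, σ), 1), ((p', σ'), 0), Z₀, Z₂] * kernel ℂ W 4 ![((p, σ), 0), ((p', σ'), 1), Z₁, Z₃]))) -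
        ∑ p' : FreqMomentum L M, ∑ σ' : Fin 2, ℓ₂ p' * (ℓ₁ p *
          (kernel ℂ W 4 ![((p, σ), 1), ((p', σ'), 0), Z₀, Z₂] * kernel ℂ W 4 ![((p, σ), 0), ((p', σ'), 1), Z₁, Z₃]))) =
      -(∑ p' : FreqMomentum L M, if matsubaraInt M p'.1 + matsubaraInt M ω + matsubaraInt M ω' + 1 = matsubaraInt M p.1 ∧ p'.2 = p.2 + Q - k - k' then
        (ℓ₂ p * ℓ₁ p' + ℓ₁ p * ℓ₂ p') *
          (kernel ℂ W 4 ![((p, 0), 1), ((p', 1), 0), Z₀, Z₂] * kernel ℂ W 4 ![((p, 0), 0), ((p', 1), 1), Z₁, Z₃]) else 0) := by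
    intro p
    rw [← hcons p (fun p p' => ℓ₂ p * ℓ₁ p' + ℓ₁ p * ℓ₂ p'), ← Finset.sum_neg_distrib]
    refine Finset.sum_congr rfl fun σ _ => ?_
    rw [← neg_add', ← Finset.sum_add_distrib]
    congr 1
    refine Finset.sum_congr rfl fun p' _ => ?_
    rw [← Finset.sum_add_distrib]
    refine Finset.sum_congr rfl fun σ' _ => ?_
    ring
  -- assemble
  have hL : ∑ p : FreqMomentum L M, ∑ σ : Fin 2, ℓ₂ p *
        (-(∑ p' : FreqMomentum L M, ∑ σ' : Fin 2, ℓ₁ p' *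
            (kernel ℂ W 4 ![((p, σ), 1), ((p', σ'), 0), Z₀, Z₂] * kernel ℂ W 4 ![((p, σ), 0), ((p', σ'), 1), Z₁, Z₃])) -
          ∑ p' : FreqMomentum L M, ∑ σ' : Fin 2, ℓ₁ p' *
            (kernel ℂ W 4 ![((p, σ), 0), ((p', σ'), 1), Z₀, Z₂] * kernel ℂ W 4 ![((p, σ), 1), ((p', σ'), 0), Z₁, Z₃])) =
      -(∑ p : FreqMomentum L M, ∑ σ : Fin 2, ∑ p' : FreqMomentum L M, ∑ σ' : Fin 2, ℓ₂ p * (ℓ₁ p' *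
            (kernel ℂ W 4 ![((p, σ), 1), ((p', σ'), 0), Z₀, Z₂] * kernel ℂ W 4 ![((p, σ), 0), ((p', σ'), 1), Z₁, Z₃]))) -
        ∑ p : FreqMomentum L M, ∑ σ : Fin 2, ∑ p' : FreqMomentum L M, ∑ σ' : Fin 2, ℓ₂ p * (ℓ₁ p' *
            (kernel ℂ W 4 ![((p, σ), 0), ((p', σ'), 1), Z₀, Z₂] * kernel ℂ W 4 ![((p, σ), 1), ((p', σ'), 0), Z₁, Z₃])) := by
    rw [← neg_add', ← Finset.sum_add_distrib, ← Finset.sum_neg_distrib]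
    refine Finset.sum_congr rfl fun p _ => ?_
    rw [← Finset.sum_add_distrib, ← Finset.sum_neg_distrib]
    refine Finset.sum_congr rfl fun σ _ => ?_
    rw [neg_add', mul_sub, mul_neg, Finset.mul_sum, Finset.mul_sum]
    simp only [Finset.mul_sum]
  rw [hL, hB]
  conv_rhs => rw [← Finset.sum_neg_distrib]
  rw [← Finset.sum_neg_distrib, ← Finset.sum_sub_distrib]
  refine Finset.sum_congr rfl fun p _ => ?_
  rw [← Finset.sum_neg_distrib, ← Finset.sum_sub_distrib, hmerge p, neg_inj]
  refine Finset.sum_congr rfl fun p' _ => ?_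
  split_ifs
  · rw [kernel_four_eq_inv_mul_vertexFn β hβ W, kernel_four_eq_inv_mul_vertexFn β hβ W]
    ring
  · ring

/-! ## §2 The assembled identity at general external frequencies -/

omit [NeZero M] in
/-- **`vertexFnW_dblFold_bubble_general` — the three-channel reading at GENERAL external frequencies.**  For a scaling-invariant even `W`, two
diagonal lines `C₁, C₂` (values `ℓ₁, ℓ₂`) and ANY external labels `(k, ω)`, `(k′, ω′)`, the quartic vertex function of the folded two-line term at
`Z = ((ω′,k′)↑+, (−ω′,Q−k′)↓+, (−ω,Q−k)↓−, (ω,k)↑−)` is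
`𝒱₄(dblFold(Δ_×(C₁)(Δ_×(C₂)(W⁰·W¹))))(Z) = 2·(βL²)⁻³·(PP + PHd − PHx − 2·S62)`:
`PP` the particle–particle loop (`bubbleSumW_pp_general`; loop label free), `PHd` the direct particle–hole loop at transfer `(ω−ω′, k−k′)`
(`bubbleSumW_phDirect_general`, conditional sum), `PHx` the crossed particle–hole loop at transfer `(ω+ω′, k+k′−Q)` (`bubbleSumW_phCrossed_general`,
conditional sum), `S62` the `W₆` vertex closed through the dressed double line (`bubbleSumW_sixTwo`).  This is the identity the continuous
organisation reads ENTRYWISE on the carrier `(TorusSite 2 L × MatsubaraIdx M)²` for its source `X(t)`; at `ω = ω′ = ω₀` it specialises to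
`vertexFnW_dblFold_bubble_pairLabels` (whose direct channel is the diagonalised form of the conditional sum). -/
theorem vertexFnW_dblFold_bubble_general (hβ : β ≠ 0) (hW0 : W ∈ evenOdd ℂ 0) (ω ω' : MatsubaraIdx M) {C₁ C₂ : Matrix (HubbardFieldIdx L M) (HubbardFieldIdx L M) ℂ}
    {ℓ₁ ℓ₂ : FreqMomentum L M → ℂ} (h₁ : contr ℂ C₁ = diagContr L M ℓ₁) (h₂ : contr ℂ C₂ = diagContr L M ℓ₂) (Q k k' : TorusSite 2 L) :
    vertexFn L M β (dblFold ℂ (grassmannLaplacian ℂ (crossCov ℂ C₁) (grassmannLaplacian ℂ (crossCov ℂ C₂)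
        (dblCopy ℂ 0 W * dblCopy ℂ 1 W)))) 4
        ![(((ω', k'), 0), 0), (((ω'.rev, Q - k'), 1), 0), (((ω.rev, Q - k), 1), 1), (((ω, k), 0), 1)] =
      2 * ((((β * (L : ℝ) ^ 2 : ℝ) : ℂ)) ^ 3)⁻¹ *
        ((∑ x : TorusSite 2 L × MatsubaraIdx M,
            (ℓ₂ (x.2, x.1) * ℓ₁ (x.2.rev, Q - x.1) + ℓ₁ (x.2, x.1) * ℓ₂ (x.2.rev, Q - x.1)) *
              (vertexFn L M β W 4 ![(((x.2, x.1), 0), 0), (((x.2.rev, Q - x.1), 1), 0), (((ω.rev, Q - k), 1), 1), (((ω, k), 0), 1)] *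
              vertexFn L M β W 4 ![(((ω', k'), 0), 0), (((ω'.rev, Q - k'), 1), 0), (((x.2.rev, Q - x.1), 1), 1), (((x.2, x.1), 0), 1)])) +
          (∑ p : FreqMomentum L M, ∑ σ : Fin 2, ∑ p' : FreqMomentum L M,
            if matsubaraInt M p'.1 + matsubaraInt M ω' = matsubaraInt M p.1 + matsubaraInt M ω ∧ p'.2 = p.2 + k - k' then
              (ℓ₂ p * ℓ₁ p' + ℓ₁ p * ℓ₂ p') *
                (vertexFn L M β W 4 ![((p, σ), 1), ((p', σ), 0), (((ω', k'), 0), 0), (((ω, k), 0), 1)] *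
                  vertexFn L M β W 4 ![((p, σ), 0), ((p', σ), 1), (((ω'.rev, Q - k'), 1), 0), (((ω.rev, Q - k), 1), 1)])
            else 0) -
          (∑ p : FreqMomentum L M, ∑ p' : FreqMomentum L M,
            if matsubaraInt M p'.1 + matsubaraInt M ω + matsubaraInt M ω' + 1 = matsubaraInt M p.1 ∧ p'.2 = p.2 + Q - k - k' then
              (ℓ₂ p * ℓ₁ p' + ℓ₁ p * ℓ₂ p') *
                (vertexFn L M β W 4
                    ![((p, 0), 1), ((p', 1), 0), (((ω', k'), 0), 0), (((ω.rev, Q - k), 1), 1)] *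
                  vertexFn L M β W 4
                    ![((p, 0), 0), ((p', 1), 1), (((ω'.rev, Q - k'), 1), 0), (((ω, k), 0), 1)])
            else 0) -
          2 * ∑ p : FreqMomentum L M, ∑ σ : Fin 2, ℓ₁ p * ℓ₂ p *
            (vertexFn L M β W 6
                ![((p, σ), 0), ((p, σ), 1), (((ω', k'), 0), 0), (((ω'.rev, Q - k'), 1), 0), (((ω.rev, Q - k), 1), 1),
                  (((ω, k), 0), 1)] *
              vertexFn L M β W 2 ![((p, σ), 0), ((p, σ), 1)])) := by
  have hL : (L : ℝ) ≠ 0 := Nat.cast_ne_zero.2 (NeZero.ne L)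
  have hb : (((β * (L : ℝ) ^ 2 : ℝ) : ℂ)) ≠ 0 := by exact_mod_cast mul_ne_zero hβ (pow_ne_zero 2 hL)
  obtain ⟨e4, e6, e2⟩ := vertexFn_consts_eq (L := L) β
  set Z₀ : HubbardFieldIdx L M := (((ω', k'), 0), 0) with hZ₀
  set Z₁ : HubbardFieldIdx L M := (((ω'.rev, Q - k'), 1), 0) with hZ₁
  set Z₂ : HubbardFieldIdx L M := (((ω.rev, Q - k), 1), 1) with hZ₂
  set Z₃ : HubbardFieldIdx L M := (((ω, k), 0), 1) with hZ₃
  have hv0 : (![Z₀, Z₁, Z₂, Z₃] : Fin 4 → HubbardFieldIdx L M) 0 = Z₀ := rfl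
  have hv1 : (![Z₀, Z₁, Z₂, Z₃] : Fin 4 → HubbardFieldIdx L M) 1 = Z₁ := rfl
  have hv2 : (![Z₀, Z₁, Z₂, Z₃] : Fin 4 → HubbardFieldIdx L M) 2 = Z₂ := rfl
  have hv3 : (![Z₀, Z₁, Z₂, Z₃] : Fin 4 → HubbardFieldIdx L M) 3 = Z₃ := rfl
  rw [vertexFn_def, show (4 - 1 : ℕ) = 3 from rfl,
    kernel_dblFold_bubble_self ℂ C₁ C₂ (hW0) ![Z₀, Z₁, Z₂, Z₃]]
  simp only [hv0, hv1, hv2, hv3]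
  rw [hZ₀, hZ₁, hZ₂, hZ₃, bubbleSumW_pp_general β hWinv hβ ω ω' h₁ h₂ Q k k', bubbleSumW_phDirect_general β hWinv hβ ω ω' h₁ h₂ Q k k',
    bubbleSumW_phCrossed_general β hWinv hβ ω ω' h₁ h₂ Q k k', bubbleSumW_sixTwo β hWinv hβ h₁ h₂, e4, e6, e2]
  field_simp
  ring


end Model

end Summit.HubbardSuperconductivity.HubbardSuperconductivity.Theorems.KLRegimeWickAbs

end
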